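import Mathlib
import HarnessLib
import Summits.MatrixMultiplication.MatrixMultiplication.Theorems.OutsiderSandwichSubsidy
import Summits.MatrixMultiplication.MatrixMultiplication.Theorems.OutsiderSandwichProductLocalisation

/-!
# OutsiderSandwich — THE RESIDUAL AS A SQUARE EXCHANGE between the two fixed tensors `⟨2,2,2⟩` and
`cw₂` (catalyst-free, diagonal-free normal form of `LaserMergeOptimal`)
(decomp-mm lens 4 «minimal counterexample / extremal reduction», gen 36, part 2/3: tensor level)

Route `route-MatrixMultiplication-OutsiderSandwich`; cut of record UNCHANGED:
`closes (h₁ : LaserTangency) (h₂ : LaserMergeOptimal) (h₃ : SummitIffLaserTangency) : ω(ℂ) = 2`,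
`LaserMergeOptimal` (stmt-27897) the declared residual; theorem-only, definition-free support.

Notation: in the tensor semiring `T(ℂ)` (`TensorClass ℂ`; `≲ = AsympLe (· ≤ ·)` = sub-exponentially
helped restriction of Kronecker powers) write `a = [⟨2,2,2⟩]`, `c = [cw₂]`; `R̃(a) = 2^ω`
(`asympRankOf_mk_matMul`) and the laser floor is `27a ≲ 4c³` (`laserFloor_asympLe`).  An EXCHANGE is
ONE asymptotic restriction `q·x ≲ p·y` between multiples of two FIXED classes — no diagonal `⟨p⟩`, no
catalyst, no bundle multiplier (contrast g35's certificates `(q + 27n)·a ≲ ⟨p⟩ ⊕ 4n·c³`, `n → ∞`).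

§1 **SQUARE EXCHANGE** (`laserMergeOptimal_iff_squareExchange`, `not_laserMergeOptimal_iff_cheapSquareExchange`)

     `LaserMergeOptimal ⟺ ∀ p q ∈ ℕ, (27q·[⟨2,2,2⟩]² ≲ 4p·[cw₂]³) → (q·[⟨2,2,2⟩] ≲ ⟨p⟩)`,
     `¬LaserMergeOptimal ⟺ ∃ (p, q) ∈ ℕ², p < q·2^ω ∧ 27q·[⟨2,2,2⟩]² ≲ 4p·[cw₂]³`

   = part 1's product localisation (`face_meets_top_iff_productExchange`, any Strassen preorder) at
   `u = 27a ≤ v = 4c³`: on `X(T(ℂ))`, `27·φ(a)² ≤ 2^ω·4φ(c)³` with equality iff `φ` is laser-TIGHT AND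
   TOP — the two defects of the residual MULTIPLY, so no multiplier `n` and no diagonal are needed.
   Instruments: every square exchange pays `p ≥ 4q` (`ζ₁`), reads `2^ω ≤ p/q` under the residual, bounds
   `F(cw₂)³ ≥ 27q·4^ω/(4p)` at top points, and a cheap one (`p < q·2^ω`) proves `ω > 2`.  CUBE form
   (`laserMergeOptimal_iff_cubeExchange`): `(27q·a³ ≲ 4p·c³) → q·4^ω ≤ p`.
§3 Critic g35 s1 typed (`cert_floor`, `cert_mono`): `(0,0,1)` is a g35 certificate (the laser floor) and
   certificates are monotone in the bundle size (the price function `π(n)` is non-increasing).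
Part 3 (`OutsiderSandwichResidualRate`) treats the LINEAR exchange `q·a ≲ p·c` and the rates `r*`, `σ*`.

Honest tags: support only (readings of the unchanged binder `h₂`; nothing finite is decided — an
exchange is an asymptotic restriction, and a cheap one exists iff the residual fails, forcing `ω > 2`).
Nearest prior art: Fritz 2017 (arXiv:1504.03661) Thm. 8.24 (rates in preordered semirings);
[cite: Zuiddam2018, Thm. 2.12] (Strassen duality); g35 `OutsiderSandwichSubsidy` (additive certificates).
References: [cite: Strassen1988, Thm. 2.3–2.4, Thm. 3.8]; [cite: Zuiddam2018, Thm. 2.12, Cor. 2.13,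
Thm. 2.15]; [cite: CoppersmithWinograd1990, §6]; [cite: ChristandlVranaZuiddam2023, §1.2, Thm. 4.20].
-/

set_option linter.dupNamespace false

noncomputable section

namespace Summit.MatrixMultiplication.MatrixMultiplication.Theorems.OutsiderSandwichExchange

open Literature.Computability.AlgebraicComplexity
open Summit.MatrixMultiplication.MatrixMultiplication.Theses.OutsiderSandwich
open Summit.MatrixMultiplication.MatrixMultiplication.Theorems.OutsiderSandwichLaserFloorCut
  (three_le_map_cwTensor)
open Summit.MatrixMultiplication.MatrixMultiplication.Theorems.OutsiderSandwichContactFace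
  (gaugePoint₁_cwTensor_two gaugePoint₁_matMulTensor_two)
open Summit.MatrixMultiplication.MatrixMultiplication.Theorems.OutsiderSandwichTopFibreTensor
  (asympRankOf_mk_matMul laserFloor_asympLe map_matMul_eq_iff_matExp_eq)
open Summit.MatrixMultiplication.MatrixMultiplication.Theorems.OutsiderSandwichFaceCertificates
open Summit.MatrixMultiplication.MatrixMultiplication.Theorems.OutsiderSandwichBundledPrice
open Summit.MatrixMultiplication.MatrixMultiplication.Theorems.OutsiderSandwichSubsidy
open Summit.MatrixMultiplication.MatrixMultiplication.Theorems.OutsiderSandwichProductLocalisation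

variable {F : SpectralMap ℂ}

/-! ## §0  Dictionary -/

/-- `φ([cw₂]) ≥ 3 > 0` on `X(T(ℂ))`. [cite: Strassen1988, Thm. 3.8] -/
theorem cw_pos : ∀ φ : TensorClass ℂ → ℝ, IsSpectralPoint (fun x y : TensorClass ℂ => x ≤ y) φ →
    0 < φ (TensorClass.mk (cwTensor ℂ 2)) := by
  intro φ hφ
  have h := three_le_map_cwTensor (TensorClass.isUniversalSpectralPoint_spectralMapOf hφ)
  rw [TensorClass.spectralMapOf_apply] at h
  linarith

/-- `1 ≤ φ([⟨2,2,2⟩]) ≤ 2^ω` on `X(T(ℂ))`. [cite: Strassen1988, Thm. 3.8; Zuiddam2018, Cor. 2.13] -/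
theorem matMul_mem_Icc (φ : TensorClass ℂ → ℝ)
    (hφ : IsSpectralPoint (fun x y : TensorClass ℂ => x ≤ y) φ) :
    1 ≤ φ (TensorClass.mk (matMulTensor ℂ 2 2 2)) ∧
      φ (TensorClass.mk (matMulTensor ℂ 2 2 2)) ≤ (2 : ℝ) ^ omega ℂ := by
  refine ⟨by simpa [hφ.map_one] using hφ.mono one_le_mk_matMul, ?_⟩
  rw [← asympRankOf_mk_matMul]
  exact hφ.le_asympRankOf (TensorClass.isStrassenPreorder ℂ) _

/-- `φ(27a) > 0` on `X(T(ℂ))`. -/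
theorem laserU_pos : ∀ φ : TensorClass ℂ → ℝ, IsSpectralPoint (fun x y : TensorClass ℂ => x ≤ y) φ →
    0 < φ (((27 : ℕ) : TensorClass ℂ) * TensorClass.mk (matMulTensor ℂ 2 2 2)) := by
  intro φ hφ
  rw [hφ.map_mul, hφ.map_natCast]
  have h1 := (matMul_mem_Icc φ hφ).1
  positivity

/-- **Soundness of a square exchange at universal points**: `27q·F(a)² ≤ 4p·F(c)³`.
[cite: Zuiddam2018, Thm. 2.12] -/
theorem squareExchange_sound {p q : ℕ}
    (hc : AsympLe (fun x y : TensorClass ℂ => x ≤ y)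
      (((27 * q : ℕ) : TensorClass ℂ) * TensorClass.mk (matMulTensor ℂ 2 2 2) ^ 2)
      (((4 * p : ℕ) : TensorClass ℂ) * TensorClass.mk (cwTensor ℂ 2) ^ 3))
    (hF : IsUniversalSpectralPoint ℂ F) :
    27 * q * F (matMulTensor ℂ 2 2 2) ^ 2 ≤ 4 * p * F (cwTensor ℂ 2) ^ 3 := by
  have hφ := TensorClass.isSpectralPoint_eval hF
  have h1 := ((TensorClass.isStrassenPreorder ℂ).asympLe_iff_forall_spectralPoint.1 hc) _ hφ
  simp only [hφ.map_mul, hφ.map_natCast, hφ.map_pow, TensorClass.eval_mk hF] at h1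
  push_cast at h1
  exact h1

/-! ## §1  The square (and cube) exchange normal form of the residual -/

/-- **THE RESIDUAL AS A SQUARE EXCHANGE (catalyst-free, ω-free):**
`LaserMergeOptimal ⟺ ∀ p q, (27q·[⟨2,2,2⟩]² ≲ 4p·[cw₂]³) → (q·[⟨2,2,2⟩] ≲ ⟨p⟩)`.
[cite: Zuiddam2018, Thm. 2.12, Cor. 2.13, Thm. 2.15; CoppersmithWinograd1990, §6; Strassen1988, Thm. 3.8] -/
theorem laserMergeOptimal_iff_squareExchange :
    LaserMergeOptimal ↔ ∀ p q : ℕ,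
      AsympLe (fun x y : TensorClass ℂ => x ≤ y)
        (((27 * q : ℕ) : TensorClass ℂ) * TensorClass.mk (matMulTensor ℂ 2 2 2) ^ 2)
        (((4 * p : ℕ) : TensorClass ℂ) * TensorClass.mk (cwTensor ℂ 2) ^ 3) →
      AsympLe (fun x y : TensorClass ℂ => x ≤ y)
        ((q : TensorClass ℂ) * TensorClass.mk (matMulTensor ℂ 2 2 2)) (p : TensorClass ℂ) := by
  rw [laserMergeOptimal_iff_exists_tight_top,
    exists_tight_iff_abstract (fun s _ => s = (2 : ℝ) ^ omega ℂ), ← asympRankOf_mk_matMul,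
    face_meets_top_iff_productExchange (TensorClass.isStrassenPreorder ℂ) laserFloor_valid laserU_pos
      one_le_mk_matMul]
  refine forall_congr' fun p => forall_congr' fun q => ?_
  have e1 : (q : TensorClass ℂ) * (TensorClass.mk (matMulTensor ℂ 2 2 2) *
      (((27 : ℕ) : TensorClass ℂ) * TensorClass.mk (matMulTensor ℂ 2 2 2))) =
      ((27 * q : ℕ) : TensorClass ℂ) * TensorClass.mk (matMulTensor ℂ 2 2 2) ^ 2 := by
    push_cast; ring
  have e2 : (p : TensorClass ℂ) * (((4 : ℕ) : TensorClass ℂ) * TensorClass.mk (cwTensor ℂ 2) ^ 3) =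
      ((4 * p : ℕ) : TensorClass ℂ) * TensorClass.mk (cwTensor ℂ 2) ^ 3 := by
    push_cast; ring
  rw [e1, e2]

/-- **NORMAL FORM OF A COUNTEREXAMPLE: one cheap square exchange.**
`¬LaserMergeOptimal ⟺ ∃ p q, p < q·2^ω ∧ 27q·[⟨2,2,2⟩]² ≲ 4p·[cw₂]³`.
[cite: Zuiddam2018, Thm. 2.12, Cor. 2.13, Thm. 2.15; CoppersmithWinograd1990, §6; Strassen1988, Thm. 3.8] -/
theorem not_laserMergeOptimal_iff_cheapSquareExchange :
    ¬ LaserMergeOptimal ↔ ∃ p q : ℕ, (p : ℝ) < q * (2 : ℝ) ^ omega ℂ ∧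
      AsympLe (fun x y : TensorClass ℂ => x ≤ y)
        (((27 * q : ℕ) : TensorClass ℂ) * TensorClass.mk (matMulTensor ℂ 2 2 2) ^ 2)
        (((4 * p : ℕ) : TensorClass ℂ) * TensorClass.mk (cwTensor ℂ 2) ^ 3) := by
  rw [laserMergeOptimal_iff_squareExchange]
  push Not
  refine exists_congr fun p => exists_congr fun q => ?_
  rw [cert_unbundled_iff, not_le, and_comm]

/-- **Every square exchange pays at least `4` a product**: `4q ≤ p` (at `ζ₁`: `27q·16 ≤ 4p·27`).
[cite: Strassen1988, Thm. 3.8] -/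
theorem four_mul_le_of_squareExchange {p q : ℕ}
    (hc : AsympLe (fun x y : TensorClass ℂ => x ≤ y)
      (((27 * q : ℕ) : TensorClass ℂ) * TensorClass.mk (matMulTensor ℂ 2 2 2) ^ 2)
      (((4 * p : ℕ) : TensorClass ℂ) * TensorClass.mk (cwTensor ℂ 2) ^ 3)) :
    4 * q ≤ p := by
  have h := squareExchange_sound hc (gaugePoint₁_isUniversalSpectralPoint ℂ)
  rw [gaugePoint₁_matMulTensor_two, gaugePoint₁_cwTensor_two] at h
  have h' : ((4 * q : ℕ) : ℝ) ≤ p := by push_cast; linarith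
  exact_mod_cast h'

/-- **A cheap square exchange proves `ω > 2`** (`4q ≤ p < q·2^ω`). [cite: Strassen1988, Thm. 3.8] -/
theorem two_lt_omega_of_cheapSquareExchange {p q : ℕ} (hlt : (p : ℝ) < q * (2 : ℝ) ^ omega ℂ)
    (hc : AsympLe (fun x y : TensorClass ℂ => x ≤ y)
      (((27 * q : ℕ) : TensorClass ℂ) * TensorClass.mk (matMulTensor ℂ 2 2 2) ^ 2)
      (((4 * p : ℕ) : TensorClass ℂ) * TensorClass.mk (cwTensor ℂ 2) ^ 3)) :
    2 < omega ℂ := by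
  have h4 : ((4 * q : ℕ) : ℝ) ≤ p := by exact_mod_cast four_mul_le_of_squareExchange hc
  push_cast at h4
  have hq : (0 : ℝ) < q := by
    rcases Nat.eq_zero_or_pos q with hq0 | hq0
    · subst hq0; simp at hlt; exact absurd hlt (not_lt.2 (Nat.cast_nonneg p))
    · exact_mod_cast hq0
  have hlt4 : (2 : ℝ) ^ (2 : ℝ) < (2 : ℝ) ^ omega ℂ := by
    rw [Real.rpow_two]
    by_contra hcon
    push Not at hcon
    nlinarith
  exact (Real.rpow_lt_rpow_left_iff one_lt_two).1 hlt4

/-- **Conditional instrument reading**: UNDER the residual every square exchange bounds `ω`: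
`2^ω ≤ p/q`. [cite: Zuiddam2018, Thm. 2.12, Cor. 2.13; Strassen1988, Thm. 3.8] -/
theorem rpow_omega_le_of_squareExchange (hL : LaserMergeOptimal) {p q : ℕ} (hq : 0 < q)
    (hc : AsympLe (fun x y : TensorClass ℂ => x ≤ y)
      (((27 * q : ℕ) : TensorClass ℂ) * TensorClass.mk (matMulTensor ℂ 2 2 2) ^ 2)
      (((4 * p : ℕ) : TensorClass ℂ) * TensorClass.mk (cwTensor ℂ 2) ^ 3)) :
    (2 : ℝ) ^ omega ℂ ≤ p / q := by
  have h1 := (cert_unbundled_iff p q).1 (laserMergeOptimal_iff_squareExchange.1 hL p q hc)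
  rw [le_div_iff₀ (by exact_mod_cast hq : (0 : ℝ) < q)]
  linarith [mul_comm (q : ℝ) ((2 : ℝ) ^ omega ℂ)]

/-- **At a TOP universal point a square exchange bounds the laser excess from below**:
`27q·4^ω ≤ 4p·F(cw₂)³`. [cite: Zuiddam2018, Thm. 2.12; Strassen1988, Thm. 3.8] -/
theorem squareExchange_top_bound {p q : ℕ}
    (hc : AsympLe (fun x y : TensorClass ℂ => x ≤ y)
      (((27 * q : ℕ) : TensorClass ℂ) * TensorClass.mk (matMulTensor ℂ 2 2 2) ^ 2)
      (((4 * p : ℕ) : TensorClass ℂ) * TensorClass.mk (cwTensor ℂ 2) ^ 3))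
    (hF : IsUniversalSpectralPoint ℂ F) (hτ : Real.logb 2 (F (matMulTensor ℂ 2 2 2)) = omega ℂ) :
    27 * q * ((2 : ℝ) ^ omega ℂ) ^ 2 ≤ 4 * p * F (cwTensor ℂ 2) ^ 3 := by
  have h := squareExchange_sound hc hF
  rwa [(map_matMul_eq_iff_matExp_eq hF).2 hτ] at h

/-- **CUBE EXCHANGE** (two top defects and one tightness defect multiply):
`LaserMergeOptimal ⟺ ∀ p q, (27q·[⟨2,2,2⟩]³ ≲ 4p·[cw₂]³) → q·4^ω ≤ p`.
[cite: Zuiddam2018, Thm. 2.12, Cor. 2.13, Thm. 2.15; CoppersmithWinograd1990, §6] -/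
theorem laserMergeOptimal_iff_cubeExchange :
    LaserMergeOptimal ↔ ∀ p q : ℕ,
      AsympLe (fun x y : TensorClass ℂ => x ≤ y)
        (((27 * q : ℕ) : TensorClass ℂ) * TensorClass.mk (matMulTensor ℂ 2 2 2) ^ 3)
        (((4 * p : ℕ) : TensorClass ℂ) * TensorClass.mk (cwTensor ℂ 2) ^ 3) →
      (q : ℝ) * ((2 : ℝ) ^ omega ℂ) ^ 2 ≤ p := by
  rw [laserMergeOptimal_iff_exists_tight_top,
    exists_tight_iff_abstract (fun s _ => s = (2 : ℝ) ^ omega ℂ), ← asympRankOf_mk_matMul,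
    face_meets_top_iff_powExchange (TensorClass.isStrassenPreorder ℂ) laserFloor_valid laserU_pos
      one_le_mk_matMul two_ne_zero]
  refine forall_congr' fun p => forall_congr' fun q => ?_
  have e1 : (q : TensorClass ℂ) * (TensorClass.mk (matMulTensor ℂ 2 2 2) ^ 2 *
      (((27 : ℕ) : TensorClass ℂ) * TensorClass.mk (matMulTensor ℂ 2 2 2))) =
      ((27 * q : ℕ) : TensorClass ℂ) * TensorClass.mk (matMulTensor ℂ 2 2 2) ^ 3 := by
    push_cast; ring
  have e2 : (p : TensorClass ℂ) * (((4 : ℕ) : TensorClass ℂ) * TensorClass.mk (cwTensor ℂ 2) ^ 3) =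
      ((4 * p : ℕ) : TensorClass ℂ) * TensorClass.mk (cwTensor ℂ 2) ^ 3 := by
    push_cast; ring
  rw [e1, e2]

/-! ## §3  Critic g35 s1: the laser floor is a certificate and certificates are monotone in `n` -/

/-- `(0, 0, 1)` is a certificate: `0·a + 1·27a ≲ 0 + 1·4c³` (the laser floor). [cite: CoppersmithWinograd1990, §6] -/
theorem cert_floor :
    AsympLe (fun x y : TensorClass ℂ => x ≤ y)
      (((0 : ℕ) : TensorClass ℂ) * TensorClass.mk (matMulTensor ℂ 2 2 2) +
        ((1 : ℕ) : TensorClass ℂ) * (((27 : ℕ) : TensorClass ℂ) * TensorClass.mk (matMulTensor ℂ 2 2 2)))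
      (((0 : ℕ) : TensorClass ℂ) +
        ((1 : ℕ) : TensorClass ℂ) * (((4 : ℕ) : TensorClass ℂ) * TensorClass.mk (cwTensor ℂ 2) ^ 3)) := by
  have e1 : ((0 : ℕ) : TensorClass ℂ) * TensorClass.mk (matMulTensor ℂ 2 2 2) +
      ((1 : ℕ) : TensorClass ℂ) * (((27 : ℕ) : TensorClass ℂ) * TensorClass.mk (matMulTensor ℂ 2 2 2)) =
      ((27 : ℕ) : TensorClass ℂ) * TensorClass.mk (matMulTensor ℂ 2 2 2) := by
    simp
  have e2 : ((0 : ℕ) : TensorClass ℂ) +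
      ((1 : ℕ) : TensorClass ℂ) * (((4 : ℕ) : TensorClass ℂ) * TensorClass.mk (cwTensor ℂ 2) ^ 3) =
      ((4 : ℕ) : TensorClass ℂ) * TensorClass.mk (cwTensor ℂ 2) ^ 3 := by
    simp
  rw [e1, e2]
  exact laserFloor_asympLe

/-- **Certificates are monotone in the bundle size** (`π(n)` is non-increasing):
`cert p q n → n ≤ n' → cert p q n'`. [cite: Zuiddam2018, Thm. 2.12; CoppersmithWinograd1990, §6] -/
theorem cert_mono {p q n n' : ℕ}
    (hc : AsympLe (fun x y : TensorClass ℂ => x ≤ y)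
      ((q : TensorClass ℂ) * TensorClass.mk (matMulTensor ℂ 2 2 2) +
        (n : TensorClass ℂ) * (((27 : ℕ) : TensorClass ℂ) * TensorClass.mk (matMulTensor ℂ 2 2 2)))
      ((p : TensorClass ℂ) + (n : TensorClass ℂ) * (((4 : ℕ) : TensorClass ℂ) * TensorClass.mk (cwTensor ℂ 2) ^ 3)))
    (hn : n ≤ n') :
    AsympLe (fun x y : TensorClass ℂ => x ≤ y)
      ((q : TensorClass ℂ) * TensorClass.mk (matMulTensor ℂ 2 2 2) +
        (n' : TensorClass ℂ) * (((27 : ℕ) : TensorClass ℂ) * TensorClass.mk (matMulTensor ℂ 2 2 2)))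
      ((p : TensorClass ℂ) + (n' : TensorClass ℂ) * (((4 : ℕ) : TensorClass ℂ) * TensorClass.mk (cwTensor ℂ 2) ^ 3)) := by
  have hS := TensorClass.isStrassenPreorder ℂ
  refine hS.asympLe_of_forall_spectralPoint _ _ fun φ hφ => ?_
  have h1 := (hS.asympLe_iff_forall_spectralPoint.1 hc) φ hφ
  have hval := laserFloor_valid φ hφ
  simp only [hφ.map_add, hφ.map_mul, hφ.map_natCast] at h1 hval ⊢
  have hn' : (n : ℝ) ≤ n' := by exact_mod_cast hn
  nlinarith [mul_le_mul_of_nonneg_left hval (sub_nonneg.2 hn')]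

end Summit.MatrixMultiplication.MatrixMultiplication.Theorems.OutsiderSandwichExchange

end
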